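import Mathlib

/-! # HonestZwanzig / PositiveMemory — Kronecker's lemma (line `Sketch`, stub A)

Support file for item stmt-AtomisticToContinuum-12694 (`PositiveMemory` of route `HonestZwanzig`,
sub-problem `FouriersLaw`), stub A of skeleton v5 of line Sketch.

For a nonnegative summable sequence `K : ℕ → ℝ` the weighted partial sums `Σ_{z<n} z·K(z)` are `o(n)`;
we prove the `ε`-form `Σ_{z<n} z K(z) ≤ ε n + C(ε)` (Kronecker's lemma for the weights `z`), which the
locality reduction of the skeleton consumes with `ε/4`. Pure real analysis, Mathlib only.

Proof: pick `Z` with tail mass `∑' k, K (k + Z) < ε` (`tendsto_sum_nat_add`) and put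
`C := Σ_{z<Z} z K(z)`. For `n = Z + m` split the range sum at `Z` (`Finset.sum_range_add`) and bound
`z K(z) ≤ n K(z)` on the upper block, whose `K`-mass is at most the full tail `∑' k, K (k + Z) < ε`
(`Summable.sum_le_tsum`); for `n < Z` the sum is at most `C` by monotonicity in the range.
-/

noncomputable section

open Finset Filter Topology

namespace Summit.AtomisticToContinuum.FouriersLaw.Theorems.HonestZwanzig.PositiveMemory

/-- **Kronecker's lemma, `ε`-form.** For a nonnegative summable `K : ℕ → ℝ` and every `ε > 0` there is
a constant `C` with `Σ_{z<n} z·K(z) ≤ ε·n + C` for all `n : ℕ`; i.e. `Σ_{z<n} z K(z) = o(n)`. -/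
theorem stub_kronecker (K : ℕ → ℝ) (hK : ∀ z, 0 ≤ K z) (hKs : Summable K) (ε : ℝ) (hε : 0 < ε) :
    ∃ C : ℝ, ∀ n : ℕ, ∑ z ∈ Finset.range n, (z : ℝ) * K z ≤ ε * n + C := by
  -- a tail of `K` of mass `< ε`
  obtain ⟨Z, hZ⟩ := Filter.eventually_atTop.1 ((tendsto_order.1 (tendsto_sum_nat_add K)).2 ε hε)
  have hZε : ∑' k, K (k + Z) < ε := hZ Z le_rfl
  have hKZ : Summable fun k => K (k + Z) := (summable_nat_add_iff Z).2 hKs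
  refine ⟨∑ z ∈ Finset.range Z, (z : ℝ) * K z, fun n => ?_⟩
  have hεn : 0 ≤ ε * n := by positivity
  obtain hn | hn := le_or_gt Z n
  · -- `n = Z + m`: split the sum at `Z`; the upper block is `≤ n · (tail mass) ≤ n ε`
    obtain ⟨m, rfl⟩ := Nat.exists_eq_add_of_le hn
    rw [Finset.sum_range_add]
    suffices h : ∑ x ∈ Finset.range m, ((Z + x : ℕ) : ℝ) * K (Z + x) ≤ ε * ((Z + m : ℕ) : ℝ) by
      linarith
    calc ∑ x ∈ Finset.range m, ((Z + x : ℕ) : ℝ) * K (Z + x)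
        ≤ ∑ x ∈ Finset.range m, ((Z + m : ℕ) : ℝ) * K (x + Z) := by
          refine Finset.sum_le_sum fun x hx => ?_
          have hxm : x < m := Finset.mem_range.1 hx
          rw [add_comm Z x]
          exact mul_le_mul_of_nonneg_right (Nat.cast_le.2 (by omega)) (hK _)
      _ = ((Z + m : ℕ) : ℝ) * ∑ x ∈ Finset.range m, K (x + Z) := (Finset.mul_sum _ _ _).symm
      _ ≤ ((Z + m : ℕ) : ℝ) * ∑' k, K (k + Z) := by
          gcongr
          exact hKZ.sum_le_tsum _ (fun k _ => hK _)
      _ ≤ ε * ((Z + m : ℕ) : ℝ) := by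
          rw [mul_comm]
          gcongr
  · -- `n < Z`: the whole sum is dominated by the constant
    calc ∑ z ∈ Finset.range n, (z : ℝ) * K z
        ≤ ∑ z ∈ Finset.range Z, (z : ℝ) * K z :=
          Finset.sum_le_sum_of_subset_of_nonneg (Finset.range_mono hn.le)
            fun z _ _ => mul_nonneg z.cast_nonneg (hK z)
      _ ≤ ε * n + ∑ z ∈ Finset.range Z, (z : ℝ) * K z := le_add_of_nonneg_left hεn

end Summit.AtomisticToContinuum.FouriersLaw.Theorems.HonestZwanzig.PositiveMemory

end
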